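import Summits.Ventures.LatticeQCDFlow.TrivializingMaps.FisherStaircaseTight
import Summits.Ventures.LatticeQCDFlow.TrivializingMaps.WilsonMeasureTrivializingMap
import Summits.Ventures.LatticeQCDFlow.TrivializingMaps.AcceptanceFootprint

/-!
HONEST FRAMING: exact (Metropolis-corrected) sampling algorithms for lattice gauge theory; figures
of merit are autocorrelation/cost numbers at stated couplings and volumes; no continuum-physics
claim.

# FisherStaircaseCumulants — the stages of THEOREM S are EQUILIBRIUM CUMULANTS, and their growth
# rate locates the Fisher zeros (THEORY-1.md §31.2, the "re-based" dictionary; lean-2 GEN-6, ours)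

Venture-side companion (OURS, never `Literature/`) of theory-1's THEOREM S family
(`FisherStaircaseChain`, `FisherStaircase`, `FisherStaircaseLength`, `FisherStaircaseZeroSet`,
`FisherStaircaseTight`, rows 92a–92e).  Cell `lqcd-flow` (pub-lqcd), unit `pub-lqcd-lean-2-g6`,
2026-08-22.

Setting.  `S` a smooth action on the ambient link space, `D[U]` Lüscher's trivial theory on `SU(n)^E`,
`Z(s) = ∫ D[U] e^{-sS} = complexMGF (-S) D[U] s` (entire, `> 0` on the real axis).  Stage `k` of a
STAIRCASE (THEOREM S) is the Taylor series of `Z′/Z` at a real coupling `x`, with coefficients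
`T_x(j) = (j!)⁻¹ (Z′/Z)^{(j)}(x)`; its radius is EXACTLY `dist(x, F_Z)`, `F_Z` the Fisher zero set
(rows 92a/92e).  THEORY-1.md §31.2 left "the identification of the stage-`k` coefficients with
cumulants of `-S` in the ensemble at `x_k`" at paper level.  This file proves it, and turns THEOREM
F″ into a statement about OBSERVABLES of the theory at coupling `x`:

* §0 (pure) `iteratedDeriv_ofReal_eq_of_differentiableOn` — a function holomorphic on an open set
  containing `ℝ` and real on `ℝ` has `G^{(k)}(x) = g^{(k)}(x)` at real points (no a-priori
  differentiability of the real restriction `g` is needed); `not_bddAbove_norm_mul_pow_of_not_summable`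
  — Cauchy–Hadamard's elementary half.
* §1 `boltzmannMeasure_eq_tilted` — Lüscher's `𝒵⁻¹ e^{-S} D[U]` IS Mathlib's exponentially tilted
  measure `D[U].tilted (-S)` (so Mathlib's `cgf`/tilted-moment calculus applies to the lattice theory).
* §2 THE DICTIONARY (`X := -S ∘ ι`, `μ_x := 𝒵⁻¹ e^{-xS} D[U]` the theory AT COUPLING `x`):
  `logDeriv_actionZ_ofReal_eq_deriv_cgf` — `(Z′/Z)(x) = cgf_X′(x)`;
  **`iteratedDeriv_logDeriv_actionZ_ofReal`** — `(Z′/Z)^{(j)}(x) = cgf_X^{(j+1)}(x)` for EVERY `j`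
  (the `(j+1)`-st cumulant of `-S` under `μ_x`): the stage-`k` data of a staircase are the cumulants
  of the action in the equilibrium ensemble at `x_k`; in particular
  **`logDeriv_actionZ_ofReal_eq_neg_integral`** — `T_x(0) = -⟨S⟩_{μ_x}` and
  **`deriv_logDeriv_actionZ_ofReal_eq_variance`** — `T_x(1) = Var_{μ_x}(S)` (Lüscher's (4.9)/FACT N2
  re-based from `x = 0` to any real coupling).
* §3 THE GROWTH LAW (THEOREM F″ in observable words): for every real `x`,
  **`tendsto_stageCoeff_norm_mul_pow`** — `|T_x(j)| r^j → 0` for every `0 ≤ r < dist(x, F_Z)`, and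
  **`not_bddAbove_stageCoeff_norm_mul_pow`** — `sup_j |T_x(j)| r^j = ∞` for every Fisher zero `s₀`
  and every `r > |x - s₀|`; i.e. `limsup_j |cgf_X^{(j+1)}(x)/j!|^{1/j} = 1/dist(x, F_Z)` EXACTLY
  (`…_cgf` forms): the distance from a real coupling to the nearest Fisher zero of the finite-volume
  partition function is determined by — and determines — the exponential growth rate of the
  normalised action cumulants measured at that coupling.  (This is the rigorous two-sided radius
  statement behind the "cumulant method" for locating partition-function zeros from high cumulants,
  Flindt–Garrahan, Phys. Rev. Lett. 110 (2013) 050601 [arXiv:1209.2524], which extracts the LEADING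
  pair asymptotically; here: every smooth lattice action, every volume, no asymptotics, no value of
  any zero.)
* §4 Wilson action: `μ_x = wilsonMeasure ρ₀ x` (tree `boltzmannMeasure_smul_ambWilsonAction`), so
  `(Z_L′/Z_L)(x) = -⟨S_W⟩_x` (mean Wilson action) and `(Z_L′/Z_L)′(x) = Var_x(S_W)` (the volume times
  the specific heat) at coupling `x`, every `L` — the first two stage coefficients of the Wilson
  staircase are the plaquette mean and the plaquette-sum variance of the ensemble being continued.

NOT CLAIMED: any value of a cumulant, of `dist(x, F_Z)` or of a zero for any `L`, `β`; any statement
about estimating cumulants by Monte Carlo (variance of estimators, sign problems); anything about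
continuation schemes other than the staircase of THEOREM S; cost / autocorrelation / continuum
statements.

References: M. Lüscher, Commun. Math. Phys. 293 (2010) 899–919, §4.2–§4.3 [bib
`Luscher2010Trivializing`]; C. Flindt, J. P. Garrahan, Phys. Rev. Lett. 110 (2013) 050601; THEORY-1.md
§31 (THEOREM S), §13.1/§24 (THEOREM F″).
-/

open MeasureTheory ProbabilityTheory Filter Topology Complex Set Metric
open Literature.MathematicalPhysics.QuantumFieldTheory
open Literature.MathematicalPhysics.QuantumFieldTheory.Luscher2010
open Literature.MathematicalPhysics.QuantumFieldTheory.WilsonFlow (coeConfig continuous_coeConfig)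
open scoped Matrix Matrix.Norms.Frobenius ContDiff

namespace Summit.Ventures.LatticeQCDFlow.TrivializingMaps

/-! ## §0 Two pure lemmas -/

section Pure

/-- **Real restriction of a holomorphic function, all orders.** If `G` is holomorphic on an open set
`U ⊇ ℝ` and real on the real axis, `G(x) = g(x)`, then `G^{(k)}(x) = g^{(k)}(x)` for every `k` and
every real `x` (the real iterated derivative of `g` exists and equals the complex one). [folklore] -/
theorem iteratedDeriv_ofReal_eq_of_differentiableOn {U : Set ℂ} (hU : IsOpen U) {G : ℂ → ℂ}
    (hG : DifferentiableOn ℂ G U) (hUre : ∀ x : ℝ, (x : ℂ) ∈ U) {g : ℝ → ℝ}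
    (h : ∀ x : ℝ, G x = g x) (k : ℕ) (x : ℝ) :
    iteratedDeriv k G x = ((iteratedDeriv k g x : ℝ) : ℂ) := by
  induction k generalizing x with
  | zero => simpa using h x
  | succ k ih =>
    have hA : AnalyticOnNhd ℂ G U := hG.analyticOnNhd hU
    have hGk : DifferentiableAt ℂ (iteratedDeriv k G) (x : ℂ) := by
      rw [iteratedDeriv_eq_iterate]
      exact ((hA.iterated_deriv k) x (hUre x)).differentiableAt
    set c : ℂ := iteratedDeriv (k + 1) G x with hc
    have hd : HasDerivAt (iteratedDeriv k G) c (x : ℂ) := by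
      rw [hc, iteratedDeriv_succ]
      exact hGk.hasDerivAt
    have hd' : HasDerivAt (fun y : ℝ => iteratedDeriv k G (y : ℂ)) c x := hd.comp_ofReal
    have hfun : (fun y : ℝ => iteratedDeriv k G (y : ℂ)) =
        fun y : ℝ => ((iteratedDeriv k g y : ℝ) : ℂ) :=
      funext fun y => ih y
    rw [hfun] at hd'
    have hre : HasDerivAt (iteratedDeriv k g) c.re x := by
      have h1 := Complex.reCLM.hasFDerivAt.comp_hasDerivAt x hd'
      have h2 : (⇑Complex.reCLM ∘ fun y : ℝ => ((iteratedDeriv k g y : ℝ) : ℂ)) =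
          iteratedDeriv k g := by
        funext y; simp
      rw [h2, Complex.reCLM_apply] at h1
      exact h1
    have him0 : c.im = 0 := by
      have h1 := Complex.imCLM.hasFDerivAt.comp_hasDerivAt x hd'
      have h2 : (⇑Complex.imCLM ∘ fun y : ℝ => ((iteratedDeriv k g y : ℝ) : ℂ)) =
          fun _ => (0 : ℝ) := by
        funext y; simp
      rw [h2, Complex.imCLM_apply] at h1
      exact h1.unique (hasDerivAt_const x 0)
    have hre' : iteratedDeriv (k + 1) g x = c.re := by
      rw [iteratedDeriv_succ]
      exact hre.deriv
    apply Complex.ext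
    · simp [hre']
    · simp [him0]

/-- **Cauchy–Hadamard, elementary half.** If `∑_j ‖a_j‖ r'^j` diverges for some `0 ≤ r' < r`, then
the sequence `‖a_j‖ r^j` is unbounded. [folklore] -/
theorem not_bddAbove_norm_mul_pow_of_not_summable {a : ℕ → ℂ} {r' r : ℝ} (hr' : 0 ≤ r')
    (hr : r' < r) (hns : ¬ Summable fun j => ‖a j‖ * r' ^ j) :
    ¬ BddAbove (Set.range fun j => ‖a j‖ * r ^ j) := by
  rintro ⟨C, hC⟩
  have hrpos : 0 < r := hr'.trans_lt hr
  have hq0 : 0 ≤ r' / r := div_nonneg hr' hrpos.le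
  have hq1 : r' / r < 1 := (div_lt_one hrpos).mpr hr
  have hC0 : 0 ≤ C := (hC ⟨0, rfl⟩).trans' (by positivity)
  refine hns (Summable.of_nonneg_of_le (fun j => by positivity) (fun j => ?_)
    ((summable_geometric_of_lt_one hq0 hq1).mul_left C))
  have hj : ‖a j‖ * r ^ j ≤ C := hC ⟨j, rfl⟩
  calc ‖a j‖ * r' ^ j = ‖a j‖ * r ^ j * (r' / r) ^ j := by
        rw [div_pow, mul_assoc, mul_div_cancel₀ _ (pow_ne_zero j hrpos.ne')]
    _ ≤ C * (r' / r) ^ j := mul_le_mul_of_nonneg_right hj (pow_nonneg hq0 j)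

end Pure

/-! ## §1 Lüscher's Boltzmann measure is Mathlib's tilted measure -/

section Tilted

variable {d L n : ℕ} [NeZero L]

/-- **`𝒵⁻¹ e^{-S} D[U] = D[U].tilted (-S)`** for every continuous action on `SU(n)^E`. [folklore] -/
theorem boltzmannMeasure_eq_tilted
    {S : GaugeConfig d L (Matrix.specialUnitaryGroup (Fin n) ℂ) → ℝ} (hS : Continuous S) :
    boltzmannMeasure S =
      (trivialMeasure (Matrix.specialUnitaryGroup (Fin n) ℂ) d L).tilted fun U => -S U := by
  rw [Gauge.boltzmannMeasure_eq_withDensity hS, Measure.tilted]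
  have hZ : (partitionFn S).toReal = ∫ U, Real.exp (-S U)
      ∂(trivialMeasure (Matrix.specialUnitaryGroup (Fin n) ℂ) d L) := by
    rw [integral_eq_lintegral_of_nonneg_ae (f := fun U => Real.exp (-S U))
      (ae_of_all _ fun U => (Real.exp_pos _).le)
      (Gauge.measurable_of_continuous (Real.continuous_exp.comp hS.neg)).aestronglyMeasurable]
    rfl
  simp_rw [hZ]

end Tilted

/-! ## §2 The dictionary: stage coefficients are cumulants of the action at coupling `x` -/

section Dictionary

variable {d L n : ℕ} [NeZero L] {S : AmbConfig d L n → ℝ}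

/-- `x ∈ interior (integrableExpSet (-S) D[U])` for every real `x` (all exponential moments exist). -/
theorem mem_interior_integrableExpSet_neg_action (hS : ContDiff ℝ ∞ S) (x : ℝ) :
    x ∈ interior (integrableExpSet (fun U => -S (coeConfig U))
      (trivialMeasure (Matrix.specialUnitaryGroup (Fin n) ℂ) d L)) := by
  rw [integrableExpSet_neg_action hS, interior_univ]
  exact mem_univ _

/-- **`(Z′/Z)(x) = cgf′(x)` on the real axis**, `cgf` the cumulant generating function of `-S ∘ ι`
under `D[U]`. [folklore] -/
theorem logDeriv_actionZ_ofReal_eq_deriv_cgf (hS : ContDiff ℝ ∞ S) (x : ℝ) :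
    deriv (complexMGF (fun U => -S (coeConfig U))
        (trivialMeasure (Matrix.specialUnitaryGroup (Fin n) ℂ) d L)) x /
      complexMGF (fun U => -S (coeConfig U))
        (trivialMeasure (Matrix.specialUnitaryGroup (Fin n) ℂ) d L) x =
      ((deriv (cgf (fun U => -S (coeConfig U))
        (trivialMeasure (Matrix.specialUnitaryGroup (Fin n) ℂ) d L)) x : ℝ) : ℂ) := by
  have hx := mem_interior_integrableExpSet_neg_action (d := d) (L := L) (n := n) hS x
  have hxre : (x : ℂ).re ∈ interior (integrableExpSet (fun U => -S (coeConfig U))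
      (trivialMeasure (Matrix.specialUnitaryGroup (Fin n) ℂ) d L)) := by simpa using hx
  rw [(hasDerivAt_complexMGF hxre).deriv, complexMGF_ofReal, deriv_cgf hx, Complex.ofReal_div,
    ← integral_complex_ofReal]
  congr 1
  refine integral_congr_ae (ae_of_all _ fun U => ?_)
  simp only [Complex.ofReal_mul, Complex.ofReal_neg, Complex.ofReal_exp]

/-- **THE DICTIONARY, all orders: `(Z′/Z)^{(j)}(x) = cgf^{(j+1)}(x)`** at every real coupling `x` —
the `j`-th Taylor coefficient of stage `x` of the staircase is `(j!)⁻¹` times the `(j+1)`-st cumulant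
of `-S` in the ensemble `𝒵⁻¹ e^{-xS} D[U]`. [ours] -/
theorem iteratedDeriv_logDeriv_actionZ_ofReal (hS : ContDiff ℝ ∞ S) (j : ℕ) (x : ℝ) :
    iteratedDeriv j (fun w => deriv (complexMGF (fun U => -S (coeConfig U))
        (trivialMeasure (Matrix.specialUnitaryGroup (Fin n) ℂ) d L)) w /
      complexMGF (fun U => -S (coeConfig U))
        (trivialMeasure (Matrix.specialUnitaryGroup (Fin n) ℂ) d L) w) x =
      ((iteratedDeriv (j + 1) (cgf (fun U => -S (coeConfig U))
        (trivialMeasure (Matrix.specialUnitaryGroup (Fin n) ℂ) d L)) x : ℝ) : ℂ) := by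
  set Z := complexMGF (fun U => -S (coeConfig U))
    (trivialMeasure (Matrix.specialUnitaryGroup (Fin n) ℂ) d L) with hZdef
  have hZd : Differentiable ℂ Z := differentiable_actionZ hS
  have hU : IsOpen {w : ℂ | Z w ≠ 0} := isOpen_ne_fun hZd.continuous continuous_const
  have hG : DifferentiableOn ℂ (fun w => deriv Z w / Z w) {w : ℂ | Z w ≠ 0} := fun w hw =>
    (((differentiable_deriv_actionZ hS) w).div (hZd w) hw).differentiableWithinAt
  have hUre : ∀ y : ℝ, (y : ℂ) ∈ {w : ℂ | Z w ≠ 0} := fun y =>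
    actionZ_ofReal_ne_zero (d := d) (L := L) (n := n) hS y
  rw [iteratedDeriv_succ', iteratedDeriv_ofReal_eq_of_differentiableOn hU hG hUre
    (fun y => logDeriv_actionZ_ofReal_eq_deriv_cgf (d := d) (L := L) (n := n) hS y) j x]

/-- **`T_x(0) = -⟨S⟩_x`**: the constant term of stage `x` is minus the mean action in the ensemble
`𝒵⁻¹ e^{-xS} D[U]` at coupling `x` (Lüscher's `Ċ^{(0)} = -⟨S⟩` re-based from `0` to `x`). [ours] -/
theorem logDeriv_actionZ_ofReal_eq_neg_integral (hS : ContDiff ℝ ∞ S) (x : ℝ) :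
    deriv (complexMGF (fun U => -S (coeConfig U))
        (trivialMeasure (Matrix.specialUnitaryGroup (Fin n) ℂ) d L)) x /
      complexMGF (fun U => -S (coeConfig U))
        (trivialMeasure (Matrix.specialUnitaryGroup (Fin n) ℂ) d L) x =
      -((∫ U, S (coeConfig U) ∂(boltzmannMeasure fun U => x * S (coeConfig U)) : ℝ) : ℂ) := by
  have hx := mem_interior_integrableExpSet_neg_action (d := d) (L := L) (n := n) hS x
  have hcont : Continuous fun U : GaugeConfig d L (Matrix.specialUnitaryGroup (Fin n) ℂ) =>
      x * S (coeConfig U) := continuous_const.mul (continuous_comp_coeConfig hS)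
  have hμ : (boltzmannMeasure fun U : GaugeConfig d L (Matrix.specialUnitaryGroup (Fin n) ℂ) =>
      x * S (coeConfig U)) = (trivialMeasure (Matrix.specialUnitaryGroup (Fin n) ℂ) d L).tilted
        fun U => x * (-S (coeConfig U)) := by
    rw [boltzmannMeasure_eq_tilted hcont]
    congr 1
    funext U
    ring
  rw [logDeriv_actionZ_ofReal_eq_deriv_cgf hS x, ← integral_tilted_mul_self hx, hμ,
    MeasureTheory.integral_neg, Complex.ofReal_neg]

/-- **`T_x(1) = Var_x(S)`**: the linear coefficient of stage `x` is the variance of the action in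
the ensemble at coupling `x` (Lüscher's `Ċ^{(1)} = ⟨S²⟩ - ⟨S⟩²` re-based). [ours] -/
theorem deriv_logDeriv_actionZ_ofReal_eq_variance (hS : ContDiff ℝ ∞ S) (x : ℝ) :
    deriv (fun w => deriv (complexMGF (fun U => -S (coeConfig U))
        (trivialMeasure (Matrix.specialUnitaryGroup (Fin n) ℂ) d L)) w /
      complexMGF (fun U => -S (coeConfig U))
        (trivialMeasure (Matrix.specialUnitaryGroup (Fin n) ℂ) d L) w) x =
      ((variance (fun U => S (coeConfig U)) (boltzmannMeasure fun U => x * S (coeConfig U)) : ℝ)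
        : ℂ) := by
  have hx := mem_interior_integrableExpSet_neg_action (d := d) (L := L) (n := n) hS x
  have hcont : Continuous fun U : GaugeConfig d L (Matrix.specialUnitaryGroup (Fin n) ℂ) =>
      x * S (coeConfig U) := continuous_const.mul (continuous_comp_coeConfig hS)
  have hμ : (boltzmannMeasure fun U : GaugeConfig d L (Matrix.specialUnitaryGroup (Fin n) ℂ) =>
      x * S (coeConfig U)) = (trivialMeasure (Matrix.specialUnitaryGroup (Fin n) ℂ) d L).tilted
        fun U => x * (-S (coeConfig U)) := by
    rw [boltzmannMeasure_eq_tilted hcont]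
    congr 1
    funext U
    ring
  rw [← iteratedDeriv_one, iteratedDeriv_logDeriv_actionZ_ofReal hS 1 x,
    show (1 + 1 : ℕ) = 2 from rfl, ← variance_tilted_mul hx, hμ]
  simp only [variance_fun_neg]

end Dictionary

/-! ## §3 The growth law: the stage coefficients locate the nearest Fisher zero -/

section Growth

variable {d L n : ℕ} [NeZero L] {S : AmbConfig d L n → ℝ}

/-- **Inside the radius the weighted coefficients die out**: for real `x` and `0 ≤ r < dist(x, F_Z)`,
`|T_x(j)| r^j → 0` (the stage at `x` is summable at `x + r`, row 92e). [ours] -/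
theorem tendsto_stageCoeff_norm_mul_pow (hS : ContDiff ℝ ∞ S) (x : ℝ) {r : ℝ} (hr0 : 0 ≤ r)
    (hr : r < infDist (x : ℂ) {s : ℂ | complexMGF (fun U => -S (coeConfig U))
      (trivialMeasure (Matrix.specialUnitaryGroup (Fin n) ℂ) d L) s = 0}) :
    Tendsto (fun j : ℕ => ‖(j.factorial : ℂ)⁻¹ *
      iteratedDeriv j (fun w => deriv (complexMGF (fun U => -S (coeConfig U))
          (trivialMeasure (Matrix.specialUnitaryGroup (Fin n) ℂ) d L)) w /
        complexMGF (fun U => -S (coeConfig U))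
          (trivialMeasure (Matrix.specialUnitaryGroup (Fin n) ℂ) d L) w) x‖ * r ^ j)
      atTop (𝓝 0) := by
  have hp : |x + r - x| < infDist (x : ℂ) {s : ℂ | complexMGF (fun U => -S (coeConfig U))
      (trivialMeasure (Matrix.specialUnitaryGroup (Fin n) ℂ) d L) s = 0} := by
    rwa [add_sub_cancel_left, abs_of_nonneg hr0]
  have h := (tendsto_zero_iff_norm_tendsto_zero.mp
    (Staircase.actionZ_stage_summable_of_lt_infDist (d := d) (L := L) (n := n) hS
      hp).tendsto_atTop_zero)
  refine h.congr fun j => ?_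
  rw [norm_mul, Complex.ofReal_add, add_sub_cancel_left, norm_pow, norm_real, Real.norm_eq_abs,
    abs_of_nonneg hr0]

/-- **Beyond a zero the weighted coefficients are unbounded**: for real `x`, a Fisher zero `s₀` and
every `r > |x - s₀|`, `sup_j |T_x(j)| r^j = ∞` (no stage converges beyond a zero, row 92a). With
`tendsto_stageCoeff_norm_mul_pow`: `limsup_j |T_x(j)|^{1/j} = 1/dist(x, F_Z)` exactly. [ours] -/
theorem not_bddAbove_stageCoeff_norm_mul_pow (hS : ContDiff ℝ ∞ S) {s₀ : ℂ}
    (hz : complexMGF (fun U => -S (coeConfig U))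
      (trivialMeasure (Matrix.specialUnitaryGroup (Fin n) ℂ) d L) s₀ = 0)
    (x : ℝ) {r : ℝ} (hr : ‖(x : ℂ) - s₀‖ < r) :
    ¬ BddAbove (Set.range fun j : ℕ => ‖(j.factorial : ℂ)⁻¹ *
      iteratedDeriv j (fun w => deriv (complexMGF (fun U => -S (coeConfig U))
          (trivialMeasure (Matrix.specialUnitaryGroup (Fin n) ℂ) d L)) w /
        complexMGF (fun U => -S (coeConfig U))
          (trivialMeasure (Matrix.specialUnitaryGroup (Fin n) ℂ) d L) w) x‖ * r ^ j) := by
  obtain ⟨r', hr'1, hr'2⟩ := exists_between hr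
  have hr'0 : 0 ≤ r' := (norm_nonneg _).trans hr'1.le
  refine not_bddAbove_norm_mul_pow_of_not_summable hr'0 hr'2 fun hsum => ?_
  have hs : ‖s₀ - (x : ℂ)‖ < ‖(((x + r' : ℝ) : ℂ)) - (x : ℂ)‖ := by
    rw [norm_sub_rev, ← Complex.ofReal_sub, add_sub_cancel_left, norm_real, Real.norm_eq_abs,
      abs_of_nonneg hr'0]
    exact hr'1
  refine logDeriv_taylor_not_summable_of_zero (differentiable_actionZ hS)
    (actionZ_ofReal_ne_zero (d := d) (L := L) (n := n) hS x) hz hs (Summable.of_norm ?_)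
  refine hsum.congr fun j => ?_
  symm
  rw [norm_mul, ← Complex.ofReal_sub, add_sub_cancel_left, norm_pow, norm_real, Real.norm_eq_abs,
    abs_of_nonneg hr'0]

/-- **The growth law in cumulant words (inside):** `|cgf^{(j+1)}(x)|/j! · r^j → 0` for
`0 ≤ r < dist(x, F_Z)`. [ours] -/
theorem tendsto_cgf_iteratedDeriv_mul_pow (hS : ContDiff ℝ ∞ S) (x : ℝ) {r : ℝ} (hr0 : 0 ≤ r)
    (hr : r < infDist (x : ℂ) {s : ℂ | complexMGF (fun U => -S (coeConfig U))
      (trivialMeasure (Matrix.specialUnitaryGroup (Fin n) ℂ) d L) s = 0}) :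
    Tendsto (fun j : ℕ => |iteratedDeriv (j + 1) (cgf (fun U => -S (coeConfig U))
        (trivialMeasure (Matrix.specialUnitaryGroup (Fin n) ℂ) d L)) x| / j.factorial * r ^ j)
      atTop (𝓝 0) := by
  refine (tendsto_stageCoeff_norm_mul_pow (d := d) (L := L) (n := n) hS x hr0 hr).congr
    fun j => ?_
  rw [iteratedDeriv_logDeriv_actionZ_ofReal hS j x, norm_mul, norm_inv, Complex.norm_natCast,
    norm_real, Real.norm_eq_abs, inv_mul_eq_div]

/-- **The growth law in cumulant words (beyond a zero):** for every Fisher zero `s₀` and every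
`r > |x - s₀|` the sequence `|cgf^{(j+1)}(x)|/j! · r^j` is unbounded — the normalised cumulants of the
action at coupling `x` grow at exponential rate AT LEAST `1/|x - s₀|`. [ours] -/
theorem not_bddAbove_cgf_iteratedDeriv_mul_pow (hS : ContDiff ℝ ∞ S) {s₀ : ℂ}
    (hz : complexMGF (fun U => -S (coeConfig U))
      (trivialMeasure (Matrix.specialUnitaryGroup (Fin n) ℂ) d L) s₀ = 0)
    (x : ℝ) {r : ℝ} (hr : ‖(x : ℂ) - s₀‖ < r) :
    ¬ BddAbove (Set.range fun j : ℕ => |iteratedDeriv (j + 1) (cgf (fun U => -S (coeConfig U))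
        (trivialMeasure (Matrix.specialUnitaryGroup (Fin n) ℂ) d L)) x| / j.factorial * r ^ j) := by
  have h := not_bddAbove_stageCoeff_norm_mul_pow (d := d) (L := L) (n := n) hS hz x hr
  intro hb
  refine h ?_
  convert hb using 2
  funext j
  rw [iteratedDeriv_logDeriv_actionZ_ofReal hS j x, norm_mul, norm_inv, Complex.norm_natCast,
    norm_real, Real.norm_eq_abs, inv_mul_eq_div]

end Growth

/-! ## §4 Wilson action: the first two stage coefficients are the plaquette mean and variance -/

section Wilson

variable {d L n : ℕ} [NeZero L]

/-- **Wilson staircase, stage `x`, constant term:** `(Z_L′/Z_L)(x) = -⟨S_W⟩_x`, the mean Wilson action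
under `wilsonMeasure ρ₀ x`, every volume. [ours] -/
theorem wilson_logDeriv_actionZ_ofReal (x : ℝ) :
    deriv (complexMGF (fun U => -ambWilsonAction (coeConfig U))
        (trivialMeasure (Matrix.specialUnitaryGroup (Fin n) ℂ) d L)) x /
      complexMGF (fun U => -ambWilsonAction (coeConfig U))
        (trivialMeasure (Matrix.specialUnitaryGroup (Fin n) ℂ) d L) x =
      -((∫ U, wilsonAction (StrongCoupling.defRep n) U ∂(wilsonMeasure (d := d) (L := L) (StrongCoupling.defRep n) x) : ℝ)
        : ℂ) := by
  rw [logDeriv_actionZ_ofReal_eq_neg_integral (d := d) (L := L) (n := n) contDiff_ambWilsonAction x,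
    StrongCoupling.boltzmannMeasure_smul_ambWilsonAction x]
  simp_rw [StrongCoupling.ambWilsonAction_coeConfig]

/-- **Wilson staircase, stage `x`, linear term:** `(Z_L′/Z_L)′(x) = Var_x(S_W)`, the variance of the
Wilson action under `wilsonMeasure ρ₀ x` (the volume times the specific heat), every volume. [ours] -/
theorem wilson_deriv_logDeriv_actionZ_ofReal (x : ℝ) :
    deriv (fun w => deriv (complexMGF (fun U => -ambWilsonAction (coeConfig U))
        (trivialMeasure (Matrix.specialUnitaryGroup (Fin n) ℂ) d L)) w /
      complexMGF (fun U => -ambWilsonAction (coeConfig U))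
        (trivialMeasure (Matrix.specialUnitaryGroup (Fin n) ℂ) d L) w) x =
      ((variance (wilsonAction (StrongCoupling.defRep n)) (wilsonMeasure (d := d) (L := L) (StrongCoupling.defRep n) x) : ℝ)
        : ℂ) := by
  rw [deriv_logDeriv_actionZ_ofReal_eq_variance (d := d) (L := L) (n := n)
    contDiff_ambWilsonAction x, StrongCoupling.boltzmannMeasure_smul_ambWilsonAction x]
  simp_rw [StrongCoupling.ambWilsonAction_coeConfig]

end Wilson

end Summit.Ventures.LatticeQCDFlow.TrivializingMaps
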